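import Literature.Probability.RandomPlanarGeometry.SAWCountMonotoneCutDoubling
import HarnessLib

/-!
# Monotonicity `cₙ ≤ cₙ₊₁` (O'Brien 1990): cut-free walks are folded — the crossing bound, the
# bounding box, and `c₁₂ ≤ c₁₃` on `ℤ²`

Sequel of `SAWCountMonotoneCutDoubling.lean` (strict cut edges `IsUpCut` / `IsDownCut`, the
cut-free walks `cutFree d n`, and the unconditional bound `cₙ ≤ cₙ₊₁ + #(T₂ ∩ cutFree d n)`,
`count_le_count_succ_add_card_doublyTrapped_cutFree`) for the door `cₙ ≤ cₙ₊₁` (O'Brien,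
*Monotonicity of the number of self-avoiding walks*, J. Stat. Phys. **59** (1990) 969–979, quoted
in BDGS 2012 §1.3 and Madras–Slade §7.1 p. 231).  This file bounds the geometry of a cut-free
self-avoiding walk:

* `CutFree.exists_upCrossing_and_downCrossing` : every lattice hyperplane `xₖ = c + ½` strictly
  inside the range of the `k`-th coordinate is crossed by the walk both upwards and downwards —
  a boundary crossed by one step only is a strict cut edge (discrete intermediate values,
  `exists_upCrossing` / `exists_downCrossing`);
* `card_upCrossing_sub_card_downCrossing` : the net number of crossings of such a boundary is
  `[end above] - [start above]`, so a boundary separating the endpoint from the origin is crossed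
  an odd number (`≥ 3`) of times;
* `CutFree.two_mul_sum_extent_add_one_le` : **the crossing bound** `2 Σ_k (M k - m k) + 1 ≤ n` for a
  cut-free `n`-step walk (`n ≥ 1`) with coordinate ranges `[m k, M k]` — each step crosses exactly
  one boundary;
* `succ_le_prod_extent` : **the box bound** `n + 1 ≤ ∏_k (M k - m k + 1)` (the sites are distinct);
* `cutFree_two_eq_empty` : on `ℤ²` the two bounds are incompatible for `1 ≤ n ≤ 10` and for
  `n = 12` (side lengths `W + 1`, `H + 1` with `2 (W + H) + 1 ≤ n` and `n + 1 ≤ (W + 1)(H + 1)`), so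
  **there is no cut-free walk of these lengths on the square lattice**, and therefore
  (`count_two_le_count_succ_of_cutFree`, `count_two_twelve_le`) **`c₁₂ ≤ c₁₃` on `ℤ²`** by cut-edge
  doubling alone — a length at which the escape residual of `SAWCountMonotoneEscapeOdd.lean`
  (`escapeResidual_nonempty_iff`: `n = 8d - 4`) is non-empty.  (At `n = 11` the `3 × 4` box passes
  both bounds, and the `32` Hamiltonian paths of a `3 × 4` box between adjacent cells are indeed
  cut-free; `8` of them are doubly trapped.)

No named facts are introduced. [cite: MadrasSlade1993, §1.1; §7.1 p. 231]
[cite: BDGS2012, §1.3 (`cₙ ≤ cₙ₊₁`, O'Brien 1990)]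
-/

noncomputable section

open Literature.Probability.LatticeModels Literature.Probability.Percolation SimpleGraph
open scoped BigOperators

namespace Literature.Probability.RandomPlanarGeometry.SAW.Zd

variable {d : ℕ}

/-! ### Steps of a nearest-neighbour walk, coordinatewise -/

/-- A step changes every coordinate by at most one. [cite: MadrasSlade1993, §1.1] -/
private theorem abs_step_le_one {n : ℕ} {ω : ℕ → Site d} (hω : ω ∈ saws d n) {t : ℕ} (ht : t < n)
    (k : Fin d) : |ω (t + 1) k - ω t k| ≤ 1 :=
  abs_sub_le_one_of_adj ((mem_saws.1 hω).2.2.1 t ht) k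

/-- A step that raises coordinate `k` is the step `+eₖ`. [cite: MadrasSlade1993, §1.1] -/
private theorem step_eq_add_single {n : ℕ} {ω : ℕ → Site d} (hω : ω ∈ saws d n) {t : ℕ}
    (ht : t < n) {k : Fin d} (hk : ω (t + 1) k = ω t k + 1) :
    ω (t + 1) = ω t + Pi.single k 1 := by
  obtain ⟨i, hi | hi⟩ := (zdGraph_adj_iff (ω t) (ω (t + 1))).1 ((mem_saws.1 hω).2.2.1 t ht)
  · by_cases hik : k = i
    · subst hik; exact hi
    · have := congrFun hi k
      rw [Pi.add_apply, Pi.single_eq_of_ne hik] at this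
      omega
  · have := congrFun hi k
    rw [Pi.add_apply] at this
    by_cases hik : k = i
    · subst hik; rw [Pi.single_eq_same] at this; omega
    · rw [Pi.single_eq_of_ne hik] at this; omega

/-- A step moves in only one coordinate. [cite: MadrasSlade1993, §1.1] -/
private theorem step_coord_unique {n : ℕ} {ω : ℕ → Site d} (hω : ω ∈ saws d n) {t : ℕ}
    (ht : t < n) {k k' : Fin d} (hk : ω (t + 1) k ≠ ω t k) (hk' : ω (t + 1) k' ≠ ω t k') :
    k = k' := by
  obtain ⟨i, hi | hi⟩ := (zdGraph_adj_iff (ω t) (ω (t + 1))).1 ((mem_saws.1 hω).2.2.1 t ht)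
  · have h1 := congrFun hi k
    have h2 := congrFun hi k'
    rw [Pi.add_apply] at h1 h2
    by_contra hne
    by_cases hik : k = i
    · subst hik
      rw [Pi.single_eq_of_ne (Ne.symm hne)] at h2
      exact hk' (by omega)
    · rw [Pi.single_eq_of_ne hik] at h1
      exact hk (by omega)
  · have h1 := congrFun hi k
    have h2 := congrFun hi k'
    rw [Pi.add_apply] at h1 h2
    by_contra hne
    by_cases hik : k = i
    · subst hik
      rw [Pi.single_eq_of_ne (Ne.symm hne)] at h2
      exact hk' (by omega)
    · rw [Pi.single_eq_of_ne hik] at h1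
      exact hk (by omega)

/-! ### Discrete intermediate values: crossings of a level boundary -/

/-- Going from `xₖ ≤ c` at time `a` to `xₖ ≥ c + 1` at time `b ≥ a`, the walk makes an upward
crossing `c → c + 1` of coordinate `k` at some step in `[a, b)`. [cite: MadrasSlade1993, §1.1] -/
private theorem exists_upCrossing {n : ℕ} {ω : ℕ → Site d} (hω : ω ∈ saws d n) {k : Fin d}
    {c : ℤ} {a b : ℕ} (hab : a ≤ b) (hb : b ≤ n) (ha : ω a k ≤ c) (hbv : c + 1 ≤ ω b k) :
    ∃ t, a ≤ t ∧ t < b ∧ ω t k = c ∧ ω (t + 1) k = c + 1 := by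
  induction b, hab using Nat.le_induction with
  | base => omega
  | succ b hab ih =>
    by_cases h : c + 1 ≤ ω b k
    · obtain ⟨t, hat, htb, h1, h2⟩ := ih (by omega) h
      exact ⟨t, hat, by omega, h1, h2⟩
    · have h1 := abs_step_le_one hω (t := b) (by omega) k
      rw [abs_le] at h1
      exact ⟨b, hab, by omega, by omega, by omega⟩

/-- Going from `xₖ ≥ c + 1` down to `xₖ ≤ c`, the walk makes a downward crossing `c + 1 → c`.
[cite: MadrasSlade1993, §1.1] -/
private theorem exists_downCrossing {n : ℕ} {ω : ℕ → Site d} (hω : ω ∈ saws d n) {k : Fin d}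
    {c : ℤ} {a b : ℕ} (hab : a ≤ b) (hb : b ≤ n) (ha : c + 1 ≤ ω a k) (hbv : ω b k ≤ c) :
    ∃ t, a ≤ t ∧ t < b ∧ ω t k = c + 1 ∧ ω (t + 1) k = c := by
  induction b, hab using Nat.le_induction with
  | base => omega
  | succ b hab ih =>
    by_cases h : ω b k ≤ c
    · obtain ⟨t, hat, htb, h1, h2⟩ := ih (by omega) h
      exact ⟨t, hat, by omega, h1, h2⟩
    · have h1 := abs_step_le_one hω (t := b) (by omega) k
      rw [abs_le] at h1
      exact ⟨b, hab, by omega, by omega, by omega⟩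

/-- In a cut-free walk an upward crossing `c → c + 1` of coordinate `k` is accompanied by a
downward crossing `c + 1 → c` (otherwise the crossing step would be an up-cut). [cite: MadrasSlade1993, §7.1] -/
private theorem exists_downCrossing_of_upCrossing {n : ℕ} {ω : ℕ → Site d} (hω : ω ∈ saws d n)
    (hcf : CutFree n ω) {k : Fin d} {c : ℤ} {t : ℕ} (ht : t < n) (h1 : ω t k = c)
    (h2 : ω (t + 1) k = c + 1) : ∃ t' < n, ω t' k = c + 1 ∧ ω (t' + 1) k = c := by
  have hstep : ω (t + 1) = ω t + Pi.single k 1 := step_eq_add_single hω ht (by omega)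
  have hncut : ¬ ((∀ i ≤ t, ω i k ≤ ω t k) ∧ ∀ i, t + 1 ≤ i → i ≤ n → ω t k + 1 ≤ ω i k) :=
    fun h => hcf t ⟨k, Or.inl ⟨ht, hstep, h.1, h.2⟩⟩
  rw [not_and_or] at hncut
  rcases hncut with h | h
  · push Not at h
    obtain ⟨i, hit, hi⟩ := h
    obtain ⟨t', -, ht't, e1, e2⟩ :=
      exists_downCrossing hω (k := k) (c := c) (a := i) (b := t) hit (by omega) (by omega) (by omega)
    exact ⟨t', by omega, e1, e2⟩
  · push Not at h
    obtain ⟨i, hti, hin, hi⟩ := h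
    obtain ⟨t', -, ht'i, e1, e2⟩ :=
      exists_downCrossing hω (k := k) (c := c) (a := t + 1) (b := i) hti hin (by omega) (by omega)
    exact ⟨t', by omega, e1, e2⟩

/-- Cut-freeness is symmetric under the mirror image. [cite: MadrasSlade1993, §7.1] -/
private theorem cutFree_neg {n : ℕ} {ω : ℕ → Site d} (hcf : CutFree n ω) : CutFree n (-ω) := by
  intro s hs
  obtain ⟨k, hk | hk⟩ := hs
  · exact hcf s ⟨k, Or.inr hk⟩
  · rw [IsDownCut, neg_neg] at hk
    exact hcf s ⟨k, Or.inl hk⟩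

/-- In a cut-free walk a downward crossing is accompanied by an upward crossing of the same
boundary. [cite: MadrasSlade1993, §7.1] -/
private theorem exists_upCrossing_of_downCrossing {n : ℕ} {ω : ℕ → Site d} (hω : ω ∈ saws d n)
    (hcf : CutFree n ω) {k : Fin d} {c : ℤ} {t : ℕ} (ht : t < n) (h1 : ω t k = c + 1)
    (h2 : ω (t + 1) k = c) : ∃ t' < n, ω t' k = c ∧ ω (t' + 1) k = c + 1 := by
  obtain ⟨t', ht', e1, e2⟩ := exists_downCrossing_of_upCrossing (neg_mem_saws hω) (cutFree_neg hcf)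
    (k := k) (c := -c - 1) ht (by simp only [Pi.neg_apply]; omega) (by simp only [Pi.neg_apply]; omega)
  simp only [Pi.neg_apply] at e1 e2
  exact ⟨t', ht', by omega, by omega⟩

/-- **Every internal level boundary of a cut-free walk is crossed both ways.** If coordinate `k`
takes a value `≤ c` and a value `≥ c + 1` during `[0, n]`, a cut-free walk has both an upward and
a downward crossing of the boundary between `c` and `c + 1`. [cite: MadrasSlade1993, §7.1] -/
theorem CutFree.exists_upCrossing_and_downCrossing {n : ℕ} {ω : ℕ → Site d} (hω : ω ∈ saws d n)
    (hcf : CutFree n ω) {k : Fin d} {c : ℤ} (hlo : ∃ i ≤ n, ω i k ≤ c)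
    (hhi : ∃ j ≤ n, c + 1 ≤ ω j k) :
    (∃ t < n, ω t k = c ∧ ω (t + 1) k = c + 1) ∧ (∃ t < n, ω t k = c + 1 ∧ ω (t + 1) k = c) := by
  obtain ⟨i, hin, hi⟩ := hlo
  obtain ⟨j, hjn, hj⟩ := hhi
  rcases Nat.lt_or_ge i j with hij | hij
  · obtain ⟨t, -, htj, e1, e2⟩ := exists_upCrossing hω (c := c) hij.le hjn hi hj
    exact ⟨⟨t, by omega, e1, e2⟩, exists_downCrossing_of_upCrossing hω hcf (by omega) e1 e2⟩
  · obtain ⟨t, -, hti, e1, e2⟩ := exists_downCrossing hω (c := c) hij hin hj hi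
    exact ⟨exists_upCrossing_of_downCrossing hω hcf (by omega) e1 e2, ⟨t, by omega, e1, e2⟩⟩

/-! ### Counting crossings: net crossings and the crossing bound -/

/-- **Net crossings.** Among the first `t` steps, the upward crossings `c → c + 1` of coordinate
`k` outnumber the downward ones by `[ω t k ≥ c + 1] - [ω 0 k ≥ c + 1]`. [cite: MadrasSlade1993, §1.1] -/
theorem card_upCrossing_sub_card_downCrossing {n : ℕ} {ω : ℕ → Site d} (hω : ω ∈ saws d n)
    (k : Fin d) (c : ℤ) {t : ℕ} (ht : t ≤ n) :
    (((Finset.range t).filter fun s => ω s k = c ∧ ω (s + 1) k = c + 1).card : ℤ) -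
        ((Finset.range t).filter fun s => ω s k = c + 1 ∧ ω (s + 1) k = c).card =
      (if c + 1 ≤ ω t k then 1 else 0) - if c + 1 ≤ ω 0 k then 1 else 0 := by
  induction t with
  | zero => simp
  | succ t ih =>
    have ih := ih (by omega)
    have h1 := abs_step_le_one hω (t := t) (by omega) k
    rw [abs_le] at h1
    rw [Finset.range_add_one, Finset.filter_insert, Finset.filter_insert]
    have hnot : t ∉ Finset.range t := Finset.notMem_range_self
    by_cases hu : ω t k = c ∧ ω (t + 1) k = c + 1
    · have hd : ¬ (ω t k = c + 1 ∧ ω (t + 1) k = c) := by omega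
      rw [if_pos hu, if_neg hd, Finset.card_insert_of_notMem fun h => hnot (Finset.mem_filter.1 h).1]
      push_cast
      split_ifs at ih ⊢ <;> omega
    · by_cases hd : ω t k = c + 1 ∧ ω (t + 1) k = c
      · rw [if_neg hu, if_pos hd,
          Finset.card_insert_of_notMem fun h => hnot (Finset.mem_filter.1 h).1]
        push_cast
        split_ifs at ih ⊢ <;> omega
      · rw [if_neg hu, if_neg hd]
        split_ifs at ih ⊢ <;> omega

/-- **The crossing bound in one coordinate.** If every boundary `c ∣ c + 1` with `m ≤ c < M` is
crossed upward at least once and downward at least once, and one boundary `c₀` at least three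
times in total, then at least `2 (M - m) + 1` steps move in coordinate `k`. [cite: MadrasSlade1993, §1.1] -/
private theorem crossing_bound_coord {n : ℕ} {ω : ℕ → Site d} (k : Fin d) {m M : ℤ} (hmM : m ≤ M)
    (hup : ∀ c, m ≤ c → c < M → ∃ t < n, ω t k = c ∧ ω (t + 1) k = c + 1)
    (hdown : ∀ c, m ≤ c → c < M → ∃ t < n, ω t k = c + 1 ∧ ω (t + 1) k = c)
    (b : ℕ) (hb : b = 0 ∨ ∃ c₀, m ≤ c₀ ∧ c₀ < M ∧
      3 ≤ ((Finset.range n).filter fun s => ω s k = c₀ ∧ ω (s + 1) k = c₀ + 1).card +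
        ((Finset.range n).filter fun s => ω s k = c₀ + 1 ∧ ω (s + 1) k = c₀).card) (hb1 : b ≤ 1) :
    2 * (M - m) + b ≤ (((Finset.range n).filter fun s => ω (s + 1) k ≠ ω s k).card : ℤ) := by
  classical
  set up : ℤ → Finset ℕ := fun c => (Finset.range n).filter fun s => ω s k = c ∧ ω (s + 1) k = c + 1
    with hup_def
  set dn : ℤ → Finset ℕ := fun c => (Finset.range n).filter fun s => ω s k = c + 1 ∧ ω (s + 1) k = c
    with hdn_def
  set mv := (Finset.range n).filter fun s => ω (s + 1) k ≠ ω s k with hmv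
  -- the crossings of the internal boundaries, all together, are distinct moving steps
  set f : ℤ → Finset ℕ := fun c => up c ∪ dn c with hf
  have hdisjUD : ∀ c, Disjoint (up c) (dn c) := by
    intro c
    rw [Finset.disjoint_left]
    intro s hsu hsd
    have h1 := (Finset.mem_filter.1 hsu).2
    have h2 := (Finset.mem_filter.1 hsd).2
    omega
  have hdisj : Set.PairwiseDisjoint (↑(Finset.Ico m M)) f := by
    intro c _ c' _ hcc'
    rw [Function.onFun, Finset.disjoint_left]
    intro s hs hs'
    rcases Finset.mem_union.1 hs with hs | hs <;> rcases Finset.mem_union.1 hs' with hs' | hs' <;>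
      have h1 := (Finset.mem_filter.1 hs).2 <;> have h2 := (Finset.mem_filter.1 hs').2 <;> omega
  have hsub : (Finset.Ico m M).biUnion f ⊆ mv := by
    intro s hs
    obtain ⟨c, -, hsc⟩ := Finset.mem_biUnion.1 hs
    rcases Finset.mem_union.1 hsc with hsc | hsc <;>
      obtain ⟨hsr, h1⟩ := Finset.mem_filter.1 hsc <;>
      exact Finset.mem_filter.2 ⟨hsr, by omega⟩
  have hcard : ∑ c ∈ Finset.Ico m M, ((up c).card + (dn c).card) ≤ mv.card := by
    calc ∑ c ∈ Finset.Ico m M, ((up c).card + (dn c).card)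
        = ∑ c ∈ Finset.Ico m M, (f c).card :=
          Finset.sum_congr rfl fun c _ => (Finset.card_union_of_disjoint (hdisjUD c)).symm
      _ = ((Finset.Ico m M).biUnion f).card := (Finset.card_biUnion hdisj).symm
      _ ≤ mv.card := Finset.card_le_card hsub
  -- each boundary contributes at least two, the boundary `c₀` at least three
  have htwo : ∀ c ∈ Finset.Ico m M, 2 ≤ (up c).card + (dn c).card := by
    intro c hc
    rw [Finset.mem_Ico] at hc
    obtain ⟨t, ht, e1, e2⟩ := hup c hc.1 hc.2
    obtain ⟨t', ht', e1', e2'⟩ := hdown c hc.1 hc.2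
    have hu : 1 ≤ (up c).card :=
      Finset.card_pos.2 ⟨t, Finset.mem_filter.2 ⟨Finset.mem_range.2 ht, e1, e2⟩⟩
    have hd : 1 ≤ (dn c).card :=
      Finset.card_pos.2 ⟨t', Finset.mem_filter.2 ⟨Finset.mem_range.2 ht', e1', e2'⟩⟩
    omega
  have hIco : ((Finset.Ico m M).card : ℤ) = M - m := by
    rw [Int.card_Ico, Int.toNat_of_nonneg (by omega)]
  rcases hb with hb | ⟨c₀, hc₀m, hc₀M, h3⟩
  · subst hb
    have h2 : ∑ c ∈ Finset.Ico m M, 2 ≤ ∑ c ∈ Finset.Ico m M, ((up c).card + (dn c).card) :=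
      Finset.sum_le_sum htwo
    rw [Finset.sum_const, smul_eq_mul] at h2
    have key : 2 * (Finset.Ico m M).card ≤ mv.card := by omega
    zify at key
    rw [hIco] at key
    push_cast
    omega
  · have hc₀ : c₀ ∈ Finset.Ico m M := Finset.mem_Ico.2 ⟨hc₀m, hc₀M⟩
    have h3' : 3 ≤ (up c₀).card + (dn c₀).card := h3
    have hsplit := Finset.add_sum_erase (Finset.Ico m M) (fun c => (up c).card + (dn c).card) hc₀
    have hrest : ∑ c ∈ (Finset.Ico m M).erase c₀, 2 ≤
        ∑ c ∈ (Finset.Ico m M).erase c₀, ((up c).card + (dn c).card) :=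
      Finset.sum_le_sum fun c hc => htwo c (Finset.mem_of_mem_erase hc)
    rw [Finset.sum_const, smul_eq_mul, Finset.card_erase_of_mem hc₀] at hrest
    have hpos : 1 ≤ (Finset.Ico m M).card := Finset.card_pos.2 ⟨c₀, hc₀⟩
    have key : 2 * (Finset.Ico m M).card + 1 ≤ mv.card := by omega
    zify at key
    rw [hIco] at key
    omega

/-- **Steps are partitioned by the coordinate they move in**: the numbers of steps moving in the
various coordinates add up to at most `n`. [cite: MadrasSlade1993, §1.1] -/
private theorem sum_card_moves_le {n : ℕ} {ω : ℕ → Site d} (hω : ω ∈ saws d n) :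
    ∑ k, ((Finset.range n).filter fun s => ω (s + 1) k ≠ ω s k).card ≤ n := by
  classical
  have hdisj : Set.PairwiseDisjoint (↑(Finset.univ : Finset (Fin d)))
      fun k => (Finset.range n).filter fun s => ω (s + 1) k ≠ ω s k := by
    intro k _ k' _ hkk'
    rw [Function.onFun, Finset.disjoint_left]
    intro s hs hs'
    obtain ⟨hsr, h1⟩ := Finset.mem_filter.1 hs
    obtain ⟨-, h2⟩ := Finset.mem_filter.1 hs'
    exact hkk' (step_coord_unique hω (Finset.mem_range.1 hsr) h1 h2)
  rw [← Finset.card_biUnion hdisj]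
  calc (Finset.univ.biUnion fun k => (Finset.range n).filter fun s => ω (s + 1) k ≠ ω s k).card
      ≤ (Finset.range n).card := Finset.card_le_card (Finset.biUnion_subset.2 fun k _ =>
          Finset.filter_subset _ _)
    _ = n := Finset.card_range n

/-- **The crossing bound for cut-free walks.** If a cut-free `n`-step self-avoiding walk (`n ≥ 1`)
attains, in each coordinate `k`, the values `m k` and `M k` (`m k ≤ M k`), then
`2 Σ_k (M k - m k) + 1 ≤ n`: every one of the `Σ_k (M k - m k)` internal level boundaries is crossed
at least twice, each step crosses exactly one boundary, and since the endpoint differs from the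
start some boundary is crossed an odd number (`≥ 3`) of times. [cite: MadrasSlade1993, §7.1] -/
theorem CutFree.two_mul_sum_extent_add_one_le {n : ℕ} {ω : ℕ → Site d} (hω : ω ∈ saws d n)
    (hcf : CutFree n ω) (hn : 1 ≤ n) (m M : Fin d → ℤ)
    (hm : ∀ k, ∃ i ≤ n, ω i k = m k) (hM : ∀ k, ∃ i ≤ n, ω i k = M k)
    (hbox : ∀ i ≤ n, ∀ k, m k ≤ ω i k ∧ ω i k ≤ M k) :
    2 * ∑ k, (M k - m k) + 1 ≤ n := by
  classical
  have h0 : ω 0 = 0 := (mem_saws.1 hω).1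
  -- the endpoint differs from the start in some coordinate `k₀`
  have hne : ω n ≠ ω 0 := by
    intro h
    have := (mem_saws.1 hω).2.2.2 (show n ∈ {i | i ≤ n} by simp)
      (show 0 ∈ {i | i ≤ n} by simp) h
    omega
  obtain ⟨k₀, hk₀⟩ : ∃ k₀, ω n k₀ ≠ 0 := by
    by_contra h
    push Not at h
    exact hne (by rw [h0]; funext k; exact h k)
  -- crossings exist for every internal boundary (cut-freeness)
  have hcross : ∀ k c, m k ≤ c → c < M k →
      (∃ t < n, ω t k = c ∧ ω (t + 1) k = c + 1) ∧ (∃ t < n, ω t k = c + 1 ∧ ω (t + 1) k = c) := by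
    intro k c hmc hcM
    obtain ⟨i, hin, hi⟩ := hm k
    obtain ⟨j, hjn, hj⟩ := hM k
    exact hcf.exists_upCrossing_and_downCrossing hω ⟨i, hin, by omega⟩ ⟨j, hjn, by omega⟩
  -- the boundary `c₀` separating `0` from `ω n k₀` is crossed an odd number, hence `≥ 3`, of times
  have hb0 := hbox 0 (Nat.zero_le n) k₀
  have hbn := hbox n le_rfl k₀
  rw [h0, Pi.zero_apply] at hb0
  obtain ⟨c₀, hmc₀, hc₀M, hodd⟩ : ∃ c₀, m k₀ ≤ c₀ ∧ c₀ < M k₀ ∧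
      ((c₀ + 1 ≤ ω n k₀ ∧ ¬ c₀ + 1 ≤ (0 : ℤ)) ∨ (¬ c₀ + 1 ≤ ω n k₀ ∧ c₀ + 1 ≤ (0 : ℤ))) := by
    by_cases hpos : 0 < ω n k₀
    · exact ⟨0, by omega, by omega, Or.inl ⟨by omega, by omega⟩⟩
    · exact ⟨ω n k₀, by omega, by omega, Or.inr ⟨by omega, by omega⟩⟩
  have hnet := card_upCrossing_sub_card_downCrossing hω k₀ c₀ (t := n) le_rfl
  rw [h0, Pi.zero_apply] at hnet
  have h3 : 3 ≤ ((Finset.range n).filter fun s => ω s k₀ = c₀ ∧ ω (s + 1) k₀ = c₀ + 1).card +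
      ((Finset.range n).filter fun s => ω s k₀ = c₀ + 1 ∧ ω (s + 1) k₀ = c₀).card := by
    obtain ⟨⟨t, ht, e1, e2⟩, ⟨t', ht', e1', e2'⟩⟩ := hcross k₀ c₀ hmc₀ hc₀M
    have hu : 1 ≤ ((Finset.range n).filter fun s => ω s k₀ = c₀ ∧ ω (s + 1) k₀ = c₀ + 1).card :=
      Finset.card_pos.2 ⟨t, Finset.mem_filter.2 ⟨Finset.mem_range.2 ht, e1, e2⟩⟩
    have hd : 1 ≤ ((Finset.range n).filter fun s => ω s k₀ = c₀ + 1 ∧ ω (s + 1) k₀ = c₀).card :=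
      Finset.card_pos.2 ⟨t', Finset.mem_filter.2 ⟨Finset.mem_range.2 ht', e1', e2'⟩⟩
    rcases hodd with ⟨ha, hb⟩ | ⟨ha, hb⟩
    · rw [if_pos ha, if_neg hb] at hnet
      omega
    · rw [if_neg ha, if_pos hb] at hnet
      omega
  -- sum the coordinatewise crossing bounds
  have hk : ∀ k, 2 * (M k - m k) + (if k = k₀ then (1 : ℤ) else 0) ≤
      (((Finset.range n).filter fun s => ω (s + 1) k ≠ ω s k).card : ℤ) := by
    intro k
    obtain ⟨i, hin, hi⟩ := hm k
    have hmM : m k ≤ M k := by have := (hbox i hin k).2; omega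
    by_cases hkk : k = k₀
    · subst hkk
      rw [if_pos rfl]
      have := crossing_bound_coord (n := n) (ω := ω) k hmM (fun c h1 h2 => (hcross k c h1 h2).1)
        (fun c h1 h2 => (hcross k c h1 h2).2) 1 (Or.inr ⟨c₀, hmc₀, hc₀M, h3⟩) le_rfl
      simpa using this
    · rw [if_neg hkk]
      have := crossing_bound_coord (n := n) (ω := ω) k hmM (fun c h1 h2 => (hcross k c h1 h2).1)
        (fun c h1 h2 => (hcross k c h1 h2).2) 0 (Or.inl rfl) (by omega)
      simpa using this
  have hsum := Finset.sum_le_sum fun k (_ : k ∈ Finset.univ) => hk k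
  rw [Finset.sum_add_distrib, Finset.sum_ite_eq' Finset.univ k₀ (fun _ => (1 : ℤ)),
    if_pos (Finset.mem_univ _), ← Finset.mul_sum] at hsum
  have htot := sum_card_moves_le hω
  zify at htot
  linarith

/-- **The bounding-box bound.** The `n + 1` distinct sites of an `n`-step self-avoiding walk lie in
the box `∏_k [m k, M k]`, so `n + 1 ≤ ∏_k (M k - m k + 1)`. [cite: MadrasSlade1993, §1.1] -/
theorem succ_le_prod_extent {n : ℕ} {ω : ℕ → Site d} (hω : ω ∈ saws d n) (m M : Fin d → ℤ)
    (hbox : ∀ i ≤ n, ∀ k, m k ≤ ω i k ∧ ω i k ≤ M k) :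
    n + 1 ≤ ∏ k, (M k - m k + 1).toNat := by
  classical
  have hinj : Set.InjOn ω ↑(Finset.range (n + 1)) := by
    intro i hi j hj h
    exact (mem_saws.1 hω).2.2.2 (show i ∈ {i | i ≤ n} by simpa [Nat.lt_succ_iff] using hi)
      (show j ∈ {i | i ≤ n} by simpa [Nat.lt_succ_iff] using hj) h
  have hmaps : ∀ i ∈ Finset.range (n + 1),
      ω i ∈ Fintype.piFinset fun k => Finset.Icc (m k) (M k) := by
    intro i hi
    rw [Fintype.mem_piFinset]
    intro k
    rw [Finset.mem_Icc]
    exact hbox i (by simpa [Nat.lt_succ_iff] using hi) k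
  have := Finset.card_le_card_of_injOn ω hmaps hinj
  rw [Finset.card_range, Fintype.card_piFinset] at this
  refine this.trans (le_of_eq (Finset.prod_congr rfl fun k _ => ?_))
  rw [Int.card_Icc]
  congr 1
  ring

/-! ### The square lattice: no cut-free walks of length `≤ 10` or `12` -/

open Classical in
/-- **On `ℤ²` there is no cut-free self-avoiding walk of length `1 ≤ n ≤ 10` or `n = 12`.**  With
`W + 1`, `H + 1` the side lengths of the bounding box, the crossing bound gives `2 (W + H) + 1 ≤ n`
and the box bound `n + 1 ≤ (W + 1)(H + 1)`; these are incompatible for `n ≤ 10` and for `n = 12`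
(for `n = 11` the `3 × 4` box works, and indeed the Hamiltonian paths of a `3 × 4` box between
adjacent cells are cut-free). [cite: MadrasSlade1993, §7.1] -/
theorem cutFree_two_eq_empty {n : ℕ} (hn : (1 ≤ n ∧ n ≤ 10) ∨ n = 12) : cutFree 2 n = ∅ := by
  classical
  rw [Finset.eq_empty_iff_forall_notMem]
  intro ω hω
  obtain ⟨hω, hcf⟩ := mem_cutFree.1 hω
  have hne : (Finset.range (n + 1)).Nonempty := ⟨0, by simp⟩
  have hmin : ∀ k : Fin 2, ∃ i ∈ Finset.range (n + 1), ∀ j ∈ Finset.range (n + 1), ω i k ≤ ω j k :=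
    fun k => Finset.exists_min_image _ (fun i => ω i k) hne
  have hmax : ∀ k : Fin 2, ∃ i ∈ Finset.range (n + 1), ∀ j ∈ Finset.range (n + 1), ω j k ≤ ω i k :=
    fun k => Finset.exists_max_image _ (fun i => ω i k) hne
  choose im him hle using hmin
  choose iM hiM hge using hmax
  set m : Fin 2 → ℤ := fun k => ω (im k) k with hm
  set M : Fin 2 → ℤ := fun k => ω (iM k) k with hM
  have hbox : ∀ i ≤ n, ∀ k, m k ≤ ω i k ∧ ω i k ≤ M k := fun i hi k =>
    ⟨hle k i (Finset.mem_range.2 (by omega)), hge k i (Finset.mem_range.2 (by omega))⟩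
  have h1 := hcf.two_mul_sum_extent_add_one_le hω (by omega) m M
    (fun k => ⟨im k, by have := Finset.mem_range.1 (him k); omega, rfl⟩)
    (fun k => ⟨iM k, by have := Finset.mem_range.1 (hiM k); omega, rfl⟩) hbox
  have h2 := succ_le_prod_extent hω m M hbox
  rw [Fin.sum_univ_two] at h1
  rw [Fin.prod_univ_two] at h2
  have hW0 : 0 ≤ M 0 - m 0 := by have := hbox 0 (by omega) 0; omega
  have hH0 : 0 ≤ M 1 - m 1 := by have := hbox 0 (by omega) 1; omega
  obtain ⟨W, hW⟩ : ∃ W : ℕ, (W : ℤ) = M 0 - m 0 := ⟨(M 0 - m 0).toNat, Int.toNat_of_nonneg hW0⟩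
  obtain ⟨H, hH⟩ : ∃ H : ℕ, (H : ℤ) = M 1 - m 1 := ⟨(M 1 - m 1).toNat, Int.toNat_of_nonneg hH0⟩
  rw [← hW, ← hH] at h1
  rw [← hW, ← hH, show ((W : ℤ) + 1).toNat = W + 1 by simp, show ((H : ℤ) + 1).toNat = H + 1 by simp]
    at h2
  have hW5 : W ≤ 5 := by omega
  have hH5 : H ≤ 5 := by omega
  interval_cases W <;> interval_cases H <;> omega

open Classical in
/-- Hence on `ℤ²` no doubly trapped walk of length `1 ≤ n ≤ 10` or `n = 12` is cut-free.
[cite: MadrasSlade1993, §7.1] -/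
theorem doublyTrapped_inter_cutFree_two_eq_empty {n : ℕ} (hn : (1 ≤ n ∧ n ≤ 10) ∨ n = 12) :
    doublyTrapped 2 n ∩ cutFree 2 n = ∅ := by
  rw [cutFree_two_eq_empty hn, Finset.inter_empty]

/-- **O'Brien's inequality on `ℤ²` at lengths `1 ≤ n ≤ 10` and `n = 12` by cut-edge doubling**: in
particular `c₁₂ ≤ c₁₃` on the square lattice, where the escape residual of
`SAWCountMonotoneEscapeOdd.lean` is non-empty. [cite: BDGS2012, §1.3 (`cₙ ≤ cₙ₊₁`, O'Brien 1990)] -/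
theorem count_two_le_count_succ_of_cutFree {n : ℕ} (hn : (1 ≤ n ∧ n ≤ 10) ∨ n = 12) :
    count 2 n ≤ count 2 (n + 1) :=
  count_le_count_succ_of_doublyTrapped_cutFree_eq_empty (doublyTrapped_inter_cutFree_two_eq_empty hn)

/-- **`c₁₂ ≤ c₁₃` on `ℤ²`.** [cite: BDGS2012, §1.3 (`cₙ ≤ cₙ₊₁`, O'Brien 1990)] -/
theorem count_two_twelve_le : count 2 12 ≤ count 2 13 :=
  count_two_le_count_succ_of_cutFree (Or.inr rfl)

end Literature.Probability.RandomPlanarGeometry.SAW.Zd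

end
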